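import Literature.AnabelianGeometry.EtaleTheta.TemperedRigidity
import Literature.AnabelianGeometry.EtaleTheta.ThetaKummerClass
import Literature.AnabelianGeometry.EtaleTheta.SettingModel
import Literature.AnabelianGeometry.EtaleTheta.Discharge.Sec2DeltaThetaTorsionFree
import Mathlib.Algebra.Module.PUnit

/-!
# [EtTh] §1 interface records `ValuationHatData` and `ThetaKummerInput`: inhabitation census
# (every setting, and the root model `ThetaSetting.model p`), and the certificate that at the root
# model EVERY `ThetaKummerInput` has trivial cyclotome identification

Mochizuki, *The étale theta function …*, Publ. RIMS **45** (2009) [EtTh], §1: Thm. 1.6 (ii), PRIMS PDF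
p. 24 ("the surjections `H¹(G_K̈, Δ_Θ) →̃ H¹(G_K̈, Ẑ(1)) →̃ (K̈^×)^∧ ↠ Ẑ` determined by the valuations on
`K̈`" — the record `ThetaSetting.ValuationHatData`, `TemperedRigidity.lean`, seat abc-iut-L2-t1) and
Prop. 1.4 (iii), p. 22 ("the 'Kummer classes' associated to `O^×_K̈`-multiples of `Θ̈`, regarded as a
regular function on `Ÿ`" — the record `ThetaSetting.ThetaKummerInput`, `ThetaKummerClass.lean`, seat
abc-iut-L2-t12) [cite: MochizukiEtTh2009, Thm 1.6 (ii) p.24]. PROOF-ONLY companion (no `def`, no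
instance, no new named fact; seat abc-iut-w5-d047 gen 4; abc-iut-L2-lead RULINGS #9 (R72), row
«NV-L2/ThetaSetting.ValuationHatData + ThetaKummerInput at `ThetaSetting.model p`»; L2 inhabitation
census rows `ThetaSetting.ValuationHatData`, `ThetaSetting.ThetaKummerInput`, 0 producers in v1).
Nothing in the cited files is edited or restated. RESULTS:

* `ValuationHatData.nonempty` — for EVERY setting `D` and EVERY `E : D.KummerData` the record is
  inhabited, by `unitsHat := E.toKddHat(O^×_K̈)` (the typed field `toKddHat_injective`, "`K̈^× ⊆ (K̈^×)^∧`"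
  p. 22, is exactly what is used); `ValuationHatData.unitsHat_inf_range` / `nonempty_of_inf_range_eq`
  — what the record PINS is precisely the trace `unitsHat ∩ K̈^× = O^×_K̈` (print's `unitsHat` = the
  closure of `O^×_K̈` = `Ker((K̈^×)^∧ ↠ Ẑ)` is ONE such subgroup; the typed record does not single it out);
  `isEmpty_sigma_valuationHatData_iff` — consequently the record is EXACTLY as inhabited as
  `KummerData` is: at the root model `ThetaSetting.model p` the Kummer data are EMPTY (abc-iut-w5-d171,
  `ThetaSetting.model_isEmpty_kummerData`, `SettingModelKummerDataEmpty.lean`), so there the Σ-type is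
  empty and the Π-statement `valuationHatData_model` holds vacuously — «needs genuine Kummer theory»,
  nothing beyond it.
* `ThetaKummerInput.nonempty` — for EVERY setting `D` (in particular at `ThetaSetting.model p`,
  `thetaKummerInput_model`) the record is inhabited by the TRIVIAL function group `Fn := 1` (all roots
  `1`, coefficients `Λ(Fn) → Δ_Θ` the trivial homomorphism). HONEST LABEL: a DEGENERATE witness of the
  typed interface — it certifies that the record's fields impose no non-degeneracy (print's
  "identification `Λ(Fn) = Ẑ(1) ≅ Δ_Θ`", p. 12, is typed as an equivariant continuous HOMOMORPHISM
  `CyclotomeCoefficients.hom`, which may be trivial), and `exists_thetaKummerInput_kummerTheta_eq_one`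
  records the consequence: at this witness the Kummer class `κΘ̈` of `Θ̈` and all `κ(c)` are `1`, so the
  theta content of Prop. 1.4 (iii) enters only through the hypotheses `ConstCompat` /
  `etaDd = kummerTheta` of `ThetaKummerClass.lean`, as that file says.
* **CERTIFICATE** `CyclotomeCoefficients.hom_eq_one_of_isOpen_of_torsionFree` (generic topological
  group theory) / `ThetaKummerInput.coeff_hom_eq_one_of_discrete` /
  `cyclotomeCoefficients_hom_eq_one_model` / `ThetaKummerInput.kummerTheta_eq_one_model`: a CONTINUOUS homomorphism out of a cyclotome
  `Λ(Fn) = lim Fn[n] ⊆ ∏_n Fn` (subspace-of-product topology, `Fn` with ANY topology) into a group in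
  which `{1}` is open kills `Λ(Fn)^N` for some `N ≥ 1` (an open neighbourhood of `1` in the product
  constrains finitely many components `n₁, …, n_k`, and `ζ^N` has trivial `n_i`-components for
  `N = ∏ n_i`), hence is TRIVIAL when the target is torsion-free. At the ROOT MODEL `(Π^tp_X)^Θ` is
  DISCRETE by construction and `Δ_Θ` is torsion-free (abc-iut-L2-t8, `ThetaSetting.deltaTheta_torsionfree`
  under `model_isEtThOrigin`; discreteness as in `SettingModel.discreteTopology_gtpTheta_model` of
  `SettingModelCompactIndependence.lean`, inlined here), so EVERY coefficient map `Λ(Fn) → Δ_Θ(model)` is `1` and EVERY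
  `T : (model p).ThetaKummerInput` has `κΘ̈ = 1`, `κ(c) = 1`: the record is inhabited at the root ONLY degenerately. What obstructs an honest
  witness there is not a field of the record but the TEMPERED TOPOLOGY of the root model (print:
  "`Δ_Θ ≅ Ẑ(1)`" PROFINITE, p. 12; cf. GAP row G-w5d187-1 «`IsCompact Δ_Θ`») — «needs the genuine
  (non-discrete) `Δ_Θ`».

HONEST FRAMING: inhabitation of TYPED records (interface non-vacuity), not a statement about the genuine
[EtTh] objects; inhabited ≠ endorsed; nothing of [EtTh] is asserted or denied; no side is taken on
[IUTchIII] Cor. 3.12; typed ≠ proved.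
-/

noncomputable section

namespace Literature.AnabelianGeometry.EtaleTheta

open Literature.AnabelianGeometry.SemiGraphs

namespace ThetaSetting

variable {p : ℕ} [Fact p.Prime]

/-! ### `ValuationHatData`: inhabited over every `KummerData`, and exactly as inhabited as `KummerData` -/

/-- **`ValuationHatData D E` is inhabited for every setting and every Kummer datum**, with
`unitsHat := toKddHat(O^×_K̈)`; the printed relation "`K̈^× ∩ Ker((K̈^×)^∧ ↠ Ẑ) = O^×_K̈`" holds for it
because `K̈^× → (K̈^×)^∧` is injective. [cite: MochizukiEtTh2009, Thm 1.6 (ii) p.24] -/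
theorem ValuationHatData.exists_unitsHat_eq_map (D : ThetaSetting p) (E : D.KummerData) :
    ∃ V : ValuationHatData D E, V.unitsHat = D.unitsOKdd.map E.toKddHat :=
  ⟨{ unitsHat := D.unitsOKdd.map E.toKddHat
     mem_unitsHat_iff := fun _ => Subgroup.mem_map_iff_mem E.toKddHat_injective }, rfl⟩

/-- **`ValuationHatData D E` is inhabited** (every `D`, every `E`).
[cite: MochizukiEtTh2009, Thm 1.6 (ii) p.24] -/
theorem ValuationHatData.nonempty (D : ThetaSetting p) (E : D.KummerData) :
    Nonempty (ValuationHatData D E) :=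
  let ⟨V, _⟩ := ValuationHatData.exists_unitsHat_eq_map D E
  ⟨V⟩

/-- **What the record pins**: for ANY `ValuationHatData`, the trace of `unitsHat` on `K̈^× ⊆ (K̈^×)^∧` is
`O^×_K̈`. [cite: MochizukiEtTh2009, Thm 1.6 (ii) p.24] -/
theorem ValuationHatData.unitsHat_inf_range {D : ThetaSetting p} {E : D.KummerData}
    (V : ValuationHatData D E) : V.unitsHat ⊓ E.toKddHat.range = D.unitsOKdd.map E.toKddHat := by
  ext x
  constructor
  · rintro ⟨hx, a, rfl⟩
    exact Subgroup.mem_map.mpr ⟨a, (V.mem_unitsHat_iff a).mp hx, rfl⟩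
  · rintro hx
    obtain ⟨a, ha, rfl⟩ := Subgroup.mem_map.mp hx
    exact ⟨(V.mem_unitsHat_iff a).mpr ha, a, rfl⟩

/-- … and conversely EVERY subgroup of `(K̈^×)^∧` with that trace is the `unitsHat` of a
`ValuationHatData` — the typed record is equivalent to the trace condition (the printed choice, the
closure of `O^×_K̈`, is one admissible subgroup among many). [cite: MochizukiEtTh2009, Thm 1.6 (ii) p.24] -/
theorem ValuationHatData.nonempty_of_inf_range_eq {D : ThetaSetting p} {E : D.KummerData}
    (U : Subgroup E.KddHat) (hU : U ⊓ E.toKddHat.range = D.unitsOKdd.map E.toKddHat) :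
    ∃ V : ValuationHatData D E, V.unitsHat = U := by
  refine ⟨{ unitsHat := U, mem_unitsHat_iff := fun a => ?_ }, rfl⟩
  constructor
  · intro ha
    have h : E.toKddHat a ∈ U ⊓ E.toKddHat.range := ⟨ha, a, rfl⟩
    rw [hU] at h
    exact (Subgroup.mem_map_iff_mem E.toKddHat_injective).mp h
  · intro ha
    have h : E.toKddHat a ∈ D.unitsOKdd.map E.toKddHat := Subgroup.mem_map.mpr ⟨a, ha, rfl⟩
    rw [← hU] at h
    exact h.1

/-- **`ValuationHatData` is exactly as inhabited as `KummerData`**: the total space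
`Σ E, ValuationHatData D E` is empty iff `D.KummerData` is. (At the root model `ThetaSetting.model p`
the right-hand side holds — `ThetaSetting.model_isEmpty_kummerData`, seat abc-iut-w5-d171 — so the
record «needs genuine Kummer theory», and nothing beyond it.) [cite: MochizukiEtTh2009, Thm 1.6 (ii) p.24] -/
theorem isEmpty_sigma_valuationHatData_iff (D : ThetaSetting p) :
    IsEmpty (Σ E : D.KummerData, ValuationHatData D E) ↔ IsEmpty D.KummerData := by
  constructor
  · intro h
    exact ⟨fun E => h.false ⟨E, (ValuationHatData.nonempty D E).some⟩⟩
  · intro h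
    exact ⟨fun x => h.false x.1⟩

/-- The nonempty form: `Σ E, ValuationHatData D E` is inhabited iff `D.KummerData` is.
[cite: MochizukiEtTh2009, Thm 1.6 (ii) p.24] -/
theorem nonempty_sigma_valuationHatData_iff (D : ThetaSetting p) :
    Nonempty (Σ E : D.KummerData, ValuationHatData D E) ↔ Nonempty D.KummerData :=
  ⟨fun ⟨x⟩ => ⟨x.1⟩, fun ⟨E⟩ => ⟨⟨E, (ValuationHatData.nonempty D E).some⟩⟩⟩

/-- At the ROOT MODEL `ThetaSetting.model p`: `ValuationHatData` exists over every Kummer datum of the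
model (vacuously informative there: the model carries no Kummer data, `model_isEmpty_kummerData`).
[cite: MochizukiEtTh2009, Thm 1.6 (ii) p.24] -/
theorem valuationHatData_model (E : (ThetaSetting.model p).KummerData) :
    Nonempty (ValuationHatData (ThetaSetting.model p) E) :=
  ValuationHatData.nonempty _ E

/-! ### `ThetaKummerInput`: inhabited over every setting by the trivial function group -/

/-- **`ThetaKummerInput` is inhabited for every setting `D`** — DEGENERATE witness: the trivial group of
functions `Fn := 1` with the trivial `Π^tp_X`-action (stabilisers `= Π^tp_X`, open), `Θ̈ := 1` and all
constants `:= 1` with the trivial compatible root systems, and the TRIVIAL coefficient homomorphism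
`Λ(Fn) → Δ_Θ` (continuous, equivariant). It certifies that the typed record imposes no
non-degeneracy: print's identification "`Λ(Fn) = Ẑ(1) ≅ Δ_Θ`" (p. 12) is typed as a homomorphism,
which may be trivial. [cite: MochizukiEtTh2009, Prop 1.4 (iii) p.22] -/
theorem ThetaKummerInput.exists_trivial (D : ThetaSetting p) :
    ∃ T : D.ThetaKummerInput, (∀ f : T.Fn, f = 1) ∧ ∀ ζ, T.coeff.hom ζ = 1 := by
  refine ⟨{ Fn := PUnit
            instTop := ⊥
            isOpen_stabilizer := fun f => ?_
            theta := 1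
            theta_mem := fun _ => Subsingleton.elim _ _
            thetaRoots := ⟨fun _ => 1, rfl, fun _ _ => Subsingleton.elim _ _⟩
            const := 1
            const_mem := fun _ _ => Subsingleton.elim _ _
            constRoots := fun _ => ⟨fun _ => 1, Subsingleton.elim _ _, fun _ _ => Subsingleton.elim _ _⟩
            coeff := { hom := 1
                       continuous_hom := continuous_const
                       hom_smul := fun g ζ => by
                         rw [MonoidHom.one_apply, MonoidHom.one_apply, map_one] } },
    fun _ => Subsingleton.elim _ _, fun _ => rfl⟩
  have h : MulAction.stabilizer D.PiTemp f = ⊤ :=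
    eq_top_iff.mpr fun g _ => MulAction.mem_stabilizer_iff.mpr (Subsingleton.elim _ _)
  rw [h, Subgroup.coe_top]
  exact isOpen_univ

/-- **`ThetaKummerInput D` is inhabited** (every `D`). [cite: MochizukiEtTh2009, Prop 1.4 (iii) p.22] -/
theorem ThetaKummerInput.nonempty (D : ThetaSetting p) : Nonempty D.ThetaKummerInput :=
  let ⟨T, _⟩ := ThetaKummerInput.exists_trivial D
  ⟨T⟩

/-- **At the degenerate witness the Kummer class of `Θ̈` and of every constant is trivial**: there is a
`ThetaKummerInput` with `κΘ̈ = 1` and `κ(c) = 1` for all `c ∈ K̈^×` — so the theta content of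
Prop. 1.4 (iii) is carried by the hypotheses `ConstCompat` / `etaDd = kummerTheta` of
`ThetaKummerClass.lean`, not by the record itself. [cite: MochizukiEtTh2009, Prop 1.4 (iii) p.22] -/
theorem exists_thetaKummerInput_kummerTheta_eq_one (D : ThetaSetting p) :
    ∃ T : D.ThetaKummerInput, T.kummerTheta = 1 ∧ ∀ c, T.kummerConst c = 1 := by
  obtain ⟨T, -, hT⟩ := ThetaKummerInput.exists_trivial D
  refine ⟨T, ?_, fun c => ?_⟩
  · rw [ThetaKummerInput.kummerTheta, CyclotomeCoefficients.kummerContClass, ← ContH1.mk_one]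
    exact ContH1.mk_congr _ (funext fun h => hT _) _ _
  · rw [ThetaKummerInput.kummerConst, CyclotomeCoefficients.kummerContClass, ← ContH1.mk_one]
    exact ContH1.mk_congr _ (funext fun h => hT _) _ _

/-- With trivial Kummer classes of constants the compatibility `ConstCompat` with ANY Kummer datum `E`
forces `inflTheta (kumYdd (toKddHat c)) = 1` for every `c ∈ K̈^×` — i.e. the degenerate witness is
compatible with genuine Kummer data only if the inflated Kummer classes of ALL of `K̈^×` vanish
(recorded as the exact shape of the guard; no claim beyond it).
[cite: MochizukiEtTh2009, Prop 1.4 (iii) p.22] -/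
theorem exists_thetaKummerInput_constCompat_iff (D : ThetaSetting p) :
    ∃ T : D.ThetaKummerInput, ∀ E : D.KummerData,
      T.ConstCompat E ↔ ∀ c : (↥D.Kdd)ˣ, D.inflTheta D.GtpYdd (E.kumYdd (E.toKddHat c)) = 1 := by
  obtain ⟨T, -, hT⟩ := exists_thetaKummerInput_kummerTheta_eq_one D
  exact ⟨T, fun E => forall_congr' fun c => by rw [hT c]⟩

end ThetaSetting

/-! ### Certificate: continuous homomorphisms out of a cyclotome into a torsion-free group with `{1}`
open are trivial -/

namespace CyclotomeCoefficients

variable {G G' : Type*} [Group G] [Group G'] [TopologicalSpace G']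
  {φ : G →* G'} {A' : Subgroup G'} [A'.Normal]
  {A : Type*} [CommGroup A] [MulDistribMulAction G A] [TopologicalSpace A]

/-- **A continuous coefficient homomorphism `Λ(A) → A'` kills `Λ(A)^N` for some `N ≥ 1` as soon as `{1}`
is open in `A'`**: the kernel is an open subgroup of `Λ(A) ⊆ ∏_n A` (subspace-of-product topology, ANY
topology on `A`), so it contains a basic neighbourhood of `1` constraining finitely many components
`n₁, …, n_k`; for `N := ∏ n_i` every `ζ^N` has `n_i`-component `(ζ_{n_i})^N = 1` (`ζ_{n_i}` is
`n_i`-torsion, `n_i ∣ N`). [cite: LANA2026Report, §6.1 p.31] -/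
theorem exists_pnat_hom_pow_eq_one (c : CyclotomeCoefficients φ A' A)
    (hopen : IsOpen ({1} : Set A')) :
    ∃ N : ℕ+, ∀ ζ : cyclotome A, c.hom (ζ ^ (N : ℕ)) = 1 := by
  have hU : IsOpen (c.hom ⁻¹' {1}) := hopen.preimage c.continuous_hom
  obtain ⟨W, hW, hWU⟩ := isOpen_induced_iff.mp hU
  have h1W : (fun _ : ℕ+ => (1 : A)) ∈ W := by
    have h1 : (1 : cyclotome A) ∈ Subtype.val ⁻¹' W := by
      rw [hWU]; exact (map_one c.hom)
    exact h1
  obtain ⟨I, u, hu, hIW⟩ := isOpen_pi_iff.mp hW _ h1W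
  refine ⟨∏ i ∈ I, i, fun ζ => ?_⟩
  have hmem : ((ζ ^ ((∏ i ∈ I, i : ℕ+) : ℕ) : cyclotome A) : ℕ+ → A) ∈ W := by
    refine hIW fun i hi => ?_
    obtain ⟨k, hk⟩ := Finset.dvd_prod_of_mem (fun j : ℕ+ => j) hi
    have hz : ((ζ ^ ((∏ i ∈ I, i : ℕ+) : ℕ) : cyclotome A) : ℕ+ → A) i = 1 := by
      rw [Subgroup.coe_pow, Pi.pow_apply, hk, PNat.mul_coe, pow_mul, cyclotome.pow_eq_one, one_pow]
    rw [hz]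
    exact (hu i hi).2
  have hker : (ζ ^ ((∏ i ∈ I, i : ℕ+) : ℕ) : cyclotome A) ∈ c.hom ⁻¹' {1} := by
    rw [← hWU]; exact hmem
  exact hker

/-- **A continuous coefficient homomorphism `Λ(A) → A'` into a TORSION-FREE group with `{1}` open (e.g.
`A'` discrete) is TRIVIAL.** [cite: LANA2026Report, §6.1 p.31] -/
theorem hom_eq_one_of_isOpen_of_torsionFree (c : CyclotomeCoefficients φ A' A)
    (hopen : IsOpen ({1} : Set A')) (htf : ∀ (a : A') (n : ℕ), n ≠ 0 → a ^ n = 1 → a = 1) :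
    c.hom = 1 := by
  obtain ⟨N, hN⟩ := c.exists_pnat_hom_pow_eq_one hopen
  exact MonoidHom.ext fun ζ => htf _ N N.ne_zero (by rw [← map_pow]; exact hN ζ)

end CyclotomeCoefficients

namespace ThetaSetting

variable {p : ℕ} [Fact p.Prime]

/-- **Over a setting with DISCRETE `(Π^tp_X)^Θ` and torsion-free `Δ_Θ`, every `ThetaKummerInput` has
TRIVIAL cyclotome identification `Λ(Fn) → Δ_Θ`.** [cite: MochizukiEtTh2009, Prop 1.4 (iii) p.22] -/
theorem ThetaKummerInput.coeff_hom_eq_one_of_discrete {D : ThetaSetting p} [DiscreteTopology D.GtpTheta]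
    (htf : ∀ t ∈ D.DeltaTheta, ∀ n : ℕ, n ≠ 0 → t ^ n = 1 → t = 1) (T : D.ThetaKummerInput) :
    T.coeff.hom = 1 :=
  T.coeff.hom_eq_one_of_isOpen_of_torsionFree (isOpen_discrete _) fun a n hn han =>
    Subtype.ext (htf a.1 a.2 n hn (by rw [← Subgroup.coe_pow, han, Subgroup.coe_one]))

/-- … hence trivial Kummer classes `κΘ̈ = 1` and `κ(c) = 1` for EVERY `ThetaKummerInput` over such a
setting. [cite: MochizukiEtTh2009, Prop 1.4 (iii) p.22] -/
theorem ThetaKummerInput.kummerTheta_eq_one_of_discrete {D : ThetaSetting p} [DiscreteTopology D.GtpTheta]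
    (htf : ∀ t ∈ D.DeltaTheta, ∀ n : ℕ, n ≠ 0 → t ^ n = 1 → t = 1) (T : D.ThetaKummerInput) :
    T.kummerTheta = 1 ∧ ∀ c, T.kummerConst c = 1 := by
  have hT : ∀ ζ, T.coeff.hom ζ = 1 := fun ζ => by
    rw [ThetaKummerInput.coeff_hom_eq_one_of_discrete htf T, MonoidHom.one_apply]
  refine ⟨?_, fun c => ?_⟩
  · rw [ThetaKummerInput.kummerTheta, CyclotomeCoefficients.kummerContClass, ← ContH1.mk_one]
    exact ContH1.mk_congr _ (funext fun h => hT _) _ _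
  · rw [ThetaKummerInput.kummerConst, CyclotomeCoefficients.kummerContClass, ← ContH1.mk_one]
    exact ContH1.mk_congr _ (funext fun h => hT _) _ _

/-- At the ROOT MODEL `ThetaSetting.model p`: `ThetaKummerInput` is inhabited (by the degenerate
witness; census row `ThetaSetting.ThetaKummerInput`). [cite: MochizukiEtTh2009, Prop 1.4 (iii) p.22] -/
theorem thetaKummerInput_model : Nonempty (ThetaSetting.model p).ThetaKummerInput :=
  ThetaKummerInput.nonempty _

/-- The root model's `Δ_Θ` is torsion-free (abc-iut-L2-t8's `deltaTheta_torsionfree` under the guard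
`model_isEtThOrigin`). [cite: MochizukiEtTh2009, §1 p.12] -/
theorem deltaTheta_torsionfree_model {t : (ThetaSetting.model p).GtpTheta}
    (ht : t ∈ (ThetaSetting.model p).DeltaTheta) {n : ℕ} (hn : n ≠ 0) (htn : t ^ n = 1) : t = 1 :=
  (ThetaSetting.model p).deltaTheta_torsionfree (ThetaSetting.model_isEtThOrigin p) ht hn htn

/-- **CERTIFICATE at the root model: EVERY continuous equivariant coefficient homomorphism
`Λ(Fn) → Δ_Θ` over `ThetaSetting.model p` is TRIVIAL**, for every `Π^tp_X`-group `Fn` with any topology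
— `(Π^tp_X)^Θ` is discrete there and `Δ_Θ` torsion-free. So `ThetaKummerInput` is inhabited at the root
ONLY degenerately; an honest witness needs the genuine (profinite, p. 12 "`Δ_Θ ≅ Ẑ(1)`") `Δ_Θ`. (The
`letI` merely names the instance `deltaTheta_normal` at the reducible `model p`.)
[cite: MochizukiEtTh2009, Prop 1.4 (iii) p.22] -/
theorem cyclotomeCoefficients_hom_eq_one_model {Fn : Type*} [CommGroup Fn]
    [MulDistribMulAction (ThetaSetting.model p).PiTemp Fn] [TopologicalSpace Fn] :
    letI := ThetaSetting.deltaTheta_normal (ThetaSetting.model p)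
    ∀ c : CyclotomeCoefficients (ThetaSetting.model p).toTheta (ThetaSetting.model p).DeltaTheta Fn,
      c.hom = 1 := by
  intro c
  haveI := ThetaSetting.deltaTheta_normal (ThetaSetting.model p)
  haveI : DiscreteTopology (ThetaSetting.model p).GtpTheta :=
    QuotientGroup.discreteTopology (isOpen_discrete _)
  exact c.hom_eq_one_of_isOpen_of_torsionFree (isOpen_discrete _) fun a n hn han =>
    Subtype.ext (deltaTheta_torsionfree_model a.2 hn (by rw [← Subgroup.coe_pow, han, Subgroup.coe_one]))

/-- **At the root model EVERY `ThetaKummerInput` has `κΘ̈ = 1` and `κ(c) = 1`** for all `c ∈ K̈^×`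
(trivial cyclotome identification, `ThetaKummerInput.coeff_hom_eq_one_of_discrete`): the
Kummer-theoretic content of Prop. 1.4 (iii) is unreachable at the root (it waits for a genuine model).
[cite: MochizukiEtTh2009, Prop 1.4 (iii) p.22] -/
theorem ThetaKummerInput.kummerTheta_eq_one_model (T : (ThetaSetting.model p).ThetaKummerInput) :
    T.kummerTheta = 1 ∧ ∀ c, T.kummerConst c = 1 := by
  haveI : DiscreteTopology (ThetaSetting.model p).GtpTheta :=
    QuotientGroup.discreteTopology (isOpen_discrete _)
  exact ThetaKummerInput.kummerTheta_eq_one_of_discrete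
    (fun t ht n hn htn => deltaTheta_torsionfree_model ht hn htn) T

/-- At the root model, `ConstCompat` of ANY `ThetaKummerInput` with ANY Kummer datum reads
"all inflated Kummer classes of `K̈^×` vanish" (and the Kummer data are in fact empty there,
`model_isEmpty_kummerData`). [cite: MochizukiEtTh2009, Prop 1.4 (iii) p.22] -/
theorem ThetaKummerInput.constCompat_model_iff (T : (ThetaSetting.model p).ThetaKummerInput)
    (E : (ThetaSetting.model p).KummerData) :
    T.ConstCompat E ↔ ∀ c, (ThetaSetting.model p).inflTheta (ThetaSetting.model p).GtpYdd
      (E.kumYdd (E.toKddHat c)) = 1 :=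
  forall_congr' fun c => by rw [(ThetaKummerInput.kummerTheta_eq_one_model T).2 c]

end ThetaSetting

end Literature.AnabelianGeometry.EtaleTheta

end
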